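import Summits.CriticalPhenomena.PercolationContinuityZ3.Theorems.PercNearOneGluingNoHeavyLowerTailCubicFourPointL1CertSemantics
import Summits.CriticalPhenomena.PercolationContinuityZ3.Theorems.PercNearOneGluingNoHeavyLowerTailCubicThreePointGluingMeasure
import Literature.Probability.Percolation.PercolationEvents
import Mathlib.MeasureTheory.Measure.Real
import HarnessLib

/-!
# Four-point certificate kernel, pattern layer: the 15 connectivity patterns of `(a,b,c,y)` under `prodBernoulli w`

Support file (prover prim-l12-p2, `--supports stmt-CriticalPhenomena-4575`).  For a vertex type `V`, weights `w`, labels `a b c y`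
(coincidences allowed) and a bond configuration `ω`: `pat a b c y ω < 15` is the index (cell order of `…L1CertKernel`) of the set partition
of the labels induced by open connection in `ω` (table `patTab` on the six connection bits `ab ac ay bc by cy`); `pre a b c y T` is the event
"pattern in the mask `T`"; `cellLaw a b c y w π = P(pattern = π)`.  Dictionary: `jn (pat ω) u v ↔ lab u ~ lab v` (`jn_pat_iff`), bits of
`maskOf` (`testBit_maskOf`), `P(pre T) = msum T cellLaw` (`real_pre`), up-closed masks give increasing events (`isUpperSet_pre`), the tables
for the gluing `a ~ y` (`joined_mergeAY`) and the swap `b ↔ c` (`joined_permBC`).  No sorries, no named facts, no `native_decide`.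
-/

namespace Summit.CriticalPhenomena.PercolationContinuityZ3.Theorems

namespace FourPointCert

open MeasureTheory Finset Literature.Probability.Percolation Literature.Probability.LatticeModels

/-! ### Tables on the six connection bits (`ab, ac, ay, bc, by, cy`) -/

/-- Pattern index of a 6-bit connection vector (inconsistent vectors go to their transitive closure). [this work] -/
def patTab : List ℕ :=
  [0, 6, 5, 13, 4, 12, 10, 14, 3, 13, 13, 13, 8, 14, 14, 14, 2, 12, 9, 14, 12, 12, 14, 14, 7, 14, 14, 14, 14, 14, 14, 14,
   1, 11, 10, 14, 10, 14, 10, 14, 7, 14, 14, 14, 14, 14, 14, 14, 7, 14, 14, 14, 14, 14, 14, 14, 7, 14, 14, 14, 14, 14, 14, 14]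

/-- Index of a bit vector. [this work] -/
def bidx (b0 b1 b2 b3 b4 b5 : Bool) : ℕ := b0.toNat + 2 * b1.toNat + 4 * b2.toNat + 8 * b3.toNat + 16 * b4.toNat + 32 * b5.toNat

/-- The pattern of a bit vector. [this work] -/
def patOfBits (b0 b1 b2 b3 b4 b5 : Bool) : ℕ := patTab.getD (bidx b0 b1 b2 b3 b4 b5) 0

/-- The `k`-th bit. [this work] -/
def bitOf (k : ℕ) (b0 b1 b2 b3 b4 b5 : Bool) : Bool :=
  match k with | 0 => b0 | 1 => b1 | 2 => b2 | 3 => b3 | 4 => b4 | _ => b5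

/-- `p ∧ q → r` on Booleans. [this work] -/
def imp3 (p q r : Bool) : Bool := !(p && q) || r

/-- Transitivity constraints of a 6-bit connection vector (bits `ab ac ay bc by cy`). [this work] -/
def cons6 (b0 b1 b2 b3 b4 b5 : Bool) : Bool :=
  imp3 b0 b3 b1 && imp3 b0 b1 b3 && imp3 b1 b3 b0 && imp3 b0 b4 b2 && imp3 b0 b2 b4 && imp3 b2 b4 b0 &&
    imp3 b1 b5 b2 && imp3 b1 b2 b5 && imp3 b2 b5 b1 && imp3 b3 b5 b4 && imp3 b3 b4 b5 && imp3 b4 b5 b3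

/-- Patterns are below 15. [this work] -/
theorem patOfBits_lt (b0 b1 b2 b3 b4 b5 : Bool) : patOfBits b0 b1 b2 b3 b4 b5 < 15 := by
  revert b0 b1 b2 b3 b4 b5; decide

/-- On consistent bit vectors the table reproduces the bits. [this work] -/
theorem joined_patOfBits : ∀ (b0 b1 b2 b3 b4 b5 : Bool), cons6 b0 b1 b2 b3 b4 b5 = true →
    ∀ k < 6, joined (patOfBits b0 b1 b2 b3 b4 b5) k = bitOf k b0 b1 b2 b3 b4 b5 := by
  decide

/-- Two patterns below 15 with the same joined pairs are equal. [this work] -/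
theorem pat_ext : ∀ π < 15, ∀ π' < 15, (∀ k < 6, joined π k = joined π' k) → π = π' := by
  decide

/-- The joined pairs after gluing `a ~ y`: `ab ∨ by`, `ac ∨ cy`, `ay`, `bc ∨ (ab ∧ cy) ∨ (by ∧ ac)`, `by ∨ ab`, `cy ∨ ac`. [this work] -/
theorem joined_mergeAY : ∀ π < 15,
    joined (mergeAY π) 0 = (joined π 0 || joined π 4) ∧ joined (mergeAY π) 1 = (joined π 1 || joined π 5) ∧ joined (mergeAY π) 2 = true ∧
      joined (mergeAY π) 3 = (joined π 3 || (joined π 0 && joined π 5) || (joined π 4 && joined π 1)) ∧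
      joined (mergeAY π) 4 = (joined π 4 || joined π 0) ∧ joined (mergeAY π) 5 = (joined π 5 || joined π 1) := by
  decide

/-- `mergeAY π < 15`. [this work] -/
theorem mergeAY_lt : ∀ π < 15, mergeAY π < 15 := by decide

/-- The pattern permutation induced by swapping the labels `b ↔ c`. [this work] -/
def permBC (π : ℕ) : ℕ := [0, 2, 1, 3, 4, 6, 5, 7, 8, 11, 12, 9, 10, 13, 14].getD π 0

/-- Joined pairs after `b ↔ c`: `ab ↔ ac`, `by ↔ cy`. [this work] -/
theorem joined_permBC : ∀ π < 15,
    joined (permBC π) 0 = joined π 1 ∧ joined (permBC π) 1 = joined π 0 ∧ joined (permBC π) 2 = joined π 2 ∧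
      joined (permBC π) 3 = joined π 3 ∧ joined (permBC π) 4 = joined π 5 ∧ joined (permBC π) 5 = joined π 4 := by
  decide

/-- `permBC π < 15`. [this work] -/
theorem permBC_lt : ∀ π < 15, permBC π < 15 := by decide

/-- `permBC` is an involution below 15. [this work] -/
theorem permBC_permBC : ∀ π < 15, permBC (permBC π) = π := by decide

/-- The values of `pairIdx`. [this work] -/
theorem pairIdx_vals : pairIdx 0 1 = 0 ∧ pairIdx 0 2 = 1 ∧ pairIdx 0 3 = 2 ∧ pairIdx 1 2 = 3 ∧ pairIdx 1 3 = 4 ∧ pairIdx 2 3 = 5 ∧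
    pairIdx 1 0 = 0 ∧ pairIdx 2 0 = 1 ∧ pairIdx 3 0 = 2 ∧ pairIdx 2 1 = 3 ∧ pairIdx 3 1 = 4 ∧ pairIdx 3 2 = 5 := by
  decide

/-- Bits of `full`. [this work] -/
theorem testBit_full (π : ℕ) : full.testBit π = decide (π < 15) := by
  rw [full, Nat.testBit_two_pow_sub_one]

/-- Bits of `maskOf P` (the loop). [this work] -/
theorem testBit_maskOf_go (P : ℕ → Bool) (π : ℕ) : ∀ (fuel i acc : ℕ),
    (maskOf.go P i fuel acc).testBit π = (acc.testBit π || (decide (i ≤ π) && decide (π < i + fuel) && P π)) := by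
  intro fuel
  induction fuel with
  | zero =>
    intro i acc
    rw [maskOf.go]
    cases h1 : acc.testBit π <;> simp
  | succ f ih =>
    intro i acc
    rw [maskOf.go, ih]
    have e1 : i + 1 + f = i + (f + 1) := by omega
    by_cases hπ : π = i
    · subst hπ
      have h2 : π < π + (f + 1) := by omega
      cases hP : P π
      · simp [h2]
      · simp [h2, Nat.testBit_or]
    · have h3 : (i + 1 ≤ π) ↔ (i ≤ π) := by omega
      cases hP : P i
      · simp [h3, e1]
      · simp [h3, e1, Nat.testBit_or, Ne.symm hπ]

/-- Bits of `maskOf P`: bit `π` is `P π` for `π < 15`. [this work] -/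
theorem testBit_maskOf (P : ℕ → Bool) (π : ℕ) : (maskOf P).testBit π = (decide (π < 15) && P π) := by
  rw [maskOf, testBit_maskOf_go]; simp

/-- Up-closed mask: a pattern whose joined pairs contain those of a pattern in `T` is again in `T`. [this work] -/
def isUp (T : ℕ) : Bool :=
  (List.range 15).all fun π => (List.range 15).all fun π' =>
    !((List.range 6).all fun k => !joined π k || joined π' k) || !T.testBit π || T.testBit π'

/-- Specification of `isUp`. [this work] -/
theorem isUp_spec {T : ℕ} (hT : isUp T = true) {π π' : ℕ} (hπ : π < 15) (hπ' : π' < 15)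
    (hk : ∀ k < 6, joined π k = true → joined π' k = true) (h : T.testBit π = true) : T.testBit π' = true := by
  simp [isUp] at hT
  rcases hT π hπ π' hπ' with (⟨k, hk6, hj, hj'⟩ | hπT) | hπ'T
  · have := hk k hk6 hj; rw [hj'] at this; exact absurd this Bool.false_ne_true
  · rw [hπT] at h; exact absurd h Bool.false_ne_true
  · exact hπ'T

/-! ### The pattern of a configuration -/

open scoped Classical

variable {V : Type*}

/-- The labels `0 = a, 1 = b, 2 = c, 3 = y`. [this work] -/
def lab (a b c y : V) : ℕ → V
  | 0 => a
  | 1 => b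
  | 2 => c
  | _ => y

/-- Connection bit of two labels. [this work] -/
noncomputable def cb (a b c y : V) (ω : BondConfig V) (u v : ℕ) : Bool := decide (ω ∈ openConn (lab a b c y u) (lab a b c y v))

/-- **The connectivity pattern** of `(a,b,c,y)` in `ω` (an index `< 15`, cell order of `…L1CertKernel`). [this work] -/
noncomputable def pat (a b c y : V) (ω : BondConfig V) : ℕ :=
  patOfBits (cb a b c y ω 0 1) (cb a b c y ω 0 2) (cb a b c y ω 0 3) (cb a b c y ω 1 2) (cb a b c y ω 1 3) (cb a b c y ω 2 3)

variable (a b c y : V)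

/-- `cb` is reflexive. [this work] -/
theorem cb_self (ω : BondConfig V) (u : ℕ) : cb a b c y ω u u = true := by
  simp only [cb, decide_eq_true_eq]; exact SimpleGraph.Reachable.refl _

/-- `cb` is symmetric. [this work] -/
theorem cb_comm (ω : BondConfig V) (u v : ℕ) : cb a b c y ω u v = cb a b c y ω v u := by
  simp only [cb]
  exact Bool.decide_congr ⟨fun h => SimpleGraph.Reachable.symm h, fun h => SimpleGraph.Reachable.symm h⟩

/-- `imp3` from a transitivity fact. [this work] -/
theorem imp3_of {P Q R : Prop} (h : P → Q → R) : imp3 (decide P) (decide Q) (decide R) = true := by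
  by_cases hp : P <;> by_cases hq : Q <;> simp [imp3, hp, hq, h]

/-- The connection bits of a configuration are consistent. [this work] -/
theorem cons6_cb (ω : BondConfig V) :
    cons6 (cb a b c y ω 0 1) (cb a b c y ω 0 2) (cb a b c y ω 0 3) (cb a b c y ω 1 2) (cb a b c y ω 1 3) (cb a b c y ω 2 3) = true := by
  simp only [cons6, cb, lab, Bool.and_eq_true]
  refine ⟨⟨⟨⟨⟨⟨⟨⟨⟨⟨⟨imp3_of fun h1 h2 => h1.trans h2, imp3_of fun h1 h2 => h1.symm.trans h2⟩, imp3_of fun h1 h2 => h1.trans h2.symm⟩,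
    imp3_of fun h1 h2 => h1.trans h2⟩, imp3_of fun h1 h2 => h1.symm.trans h2⟩, imp3_of fun h1 h2 => h1.trans h2.symm⟩,
    imp3_of fun h1 h2 => h1.trans h2⟩, imp3_of fun h1 h2 => h1.symm.trans h2⟩, imp3_of fun h1 h2 => h1.trans h2.symm⟩,
    imp3_of fun h1 h2 => h1.trans h2⟩, imp3_of fun h1 h2 => h1.symm.trans h2⟩, imp3_of fun h1 h2 => h1.trans h2.symm⟩

/-- Patterns are below 15. [this work] -/
theorem pat_lt (ω : BondConfig V) : pat a b c y ω < 15 := patOfBits_lt _ _ _ _ _ _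

/-- The joined pairs of the pattern are the connection bits. [this work] -/
theorem joined_pat (ω : BondConfig V) {k : ℕ} (hk : k < 6) :
    joined (pat a b c y ω) k = bitOf k (cb a b c y ω 0 1) (cb a b c y ω 0 2) (cb a b c y ω 0 3) (cb a b c y ω 1 2) (cb a b c y ω 1 3)
      (cb a b c y ω 2 3) :=
  joined_patOfBits _ _ _ _ _ _ (cons6_cb a b c y ω) k hk

/-- **The pattern has the right joined pairs**: `jn (pat ω) u v ↔ lab u ~ lab v` (`u, v < 4`). [this work] -/
theorem jn_pat (ω : BondConfig V) {u v : ℕ} (hu : u < 4) (hv : v < 4) : jn (pat a b c y ω) u v = cb a b c y ω u v := by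
  have k0 := joined_pat a b c y ω (show 0 < 6 by norm_num)
  have k1 := joined_pat a b c y ω (show 1 < 6 by norm_num)
  have k2 := joined_pat a b c y ω (show 2 < 6 by norm_num)
  have k3 := joined_pat a b c y ω (show 3 < 6 by norm_num)
  have k4 := joined_pat a b c y ω (show 4 < 6 by norm_num)
  have k5 := joined_pat a b c y ω (show 5 < 6 by norm_num)
  simp only [bitOf] at k0 k1 k2 k3 k4 k5
  have hp := pairIdx_vals
  unfold jn
  by_cases huv : u = v
  · subst huv; simp [cb_self]
  · rw [if_neg huv]
    interval_cases u <;> interval_cases v <;> first | exact absurd rfl huv |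
      simp only [hp, k0, k1, k2, k3, k4, k5, cb_comm a b c y ω 1 0, cb_comm a b c y ω 2 0, cb_comm a b c y ω 3 0,
        cb_comm a b c y ω 2 1, cb_comm a b c y ω 3 1, cb_comm a b c y ω 3 2]

/-- Membership form of `jn_pat`. [this work] -/
theorem jn_pat_iff (ω : BondConfig V) {u v : ℕ} (hu : u < 4) (hv : v < 4) :
    jn (pat a b c y ω) u v = true ↔ ω ∈ openConn (lab a b c y u) (lab a b c y v) := by
  rw [jn_pat a b c y ω hu hv, cb, decide_eq_true_eq]

/-! ### Mask events -/

/-- The event "the pattern lies in the mask `T`". [this work] -/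
def pre (T : ℕ) : Set (BondConfig V) := {ω | T.testBit (pat a b c y ω) = true}

/-- Membership in `pre`. [this work] -/
@[simp] theorem mem_pre (T : ℕ) (ω : BondConfig V) : ω ∈ pre a b c y T ↔ T.testBit (pat a b c y ω) = true := Iff.rfl

/-- `pre` of an intersection of masks. [this work] -/
theorem pre_and (T₁ T₂ : ℕ) : pre a b c y (T₁ &&& T₂) = pre a b c y T₁ ∩ pre a b c y T₂ := by
  ext ω; simp [pre, Nat.testBit_and]

/-- `pre` of a union of masks. [this work] -/
theorem pre_or (T₁ T₂ : ℕ) : pre a b c y (T₁ ||| T₂) = pre a b c y T₁ ∪ pre a b c y T₂ := by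
  ext ω; simp [pre, Nat.testBit_or]

/-- `pre` of the complement within `full`. [this work] -/
theorem pre_xor_full (T : ℕ) : pre a b c y (full ^^^ T) = (pre a b c y T)ᶜ := by
  ext ω; simp [pre, Nat.testBit_xor, testBit_full, pat_lt]

/-- `pre full` is everything. [this work] -/
theorem pre_full : pre a b c y full = Set.univ := by
  ext ω; simp [pre, testBit_full, pat_lt]

/-- `pre (maskOf P)` is the event `P (pat ω)`. [this work] -/
theorem mem_pre_maskOf (P : ℕ → Bool) (ω : BondConfig V) : ω ∈ pre a b c y (maskOf P) ↔ P (pat a b c y ω) = true := by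
  simp [pre, testBit_maskOf, pat_lt]

/-- Joined pairs are monotone in the configuration. [this work] -/
theorem joined_pat_mono {ω ω' : BondConfig V} (hle : ω ≤ ω') {k : ℕ} (hk : k < 6) (h : joined (pat a b c y ω) k = true) :
    joined (pat a b c y ω') k = true := by
  rw [joined_pat a b c y ω hk] at h
  rw [joined_pat a b c y ω' hk]
  interval_cases k <;> simp only [bitOf, cb, decide_eq_true_eq] at h ⊢ <;> exact isUpperSet_openConn _ _ hle h

/-- **An up-closed mask gives an increasing event.** [this work] -/
theorem isUpperSet_pre {T : ℕ} (hT : isUp T = true) : IsUpperSet (pre a b c y T) := fun _ _ hle hω =>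
  isUp_spec hT (pat_lt a b c y _) (pat_lt a b c y _) (fun _ hk h => joined_pat_mono a b c y hle hk h) hω

/-- `pre T` as a preimage of a finite set of patterns. [this work] -/
theorem pre_eq_preimage (T : ℕ) :
    pre a b c y T = pat a b c y ⁻¹' (↑((range 15).filter fun π => T.testBit π = true) : Set ℕ) := by
  ext ω
  simp only [mem_pre, Set.mem_preimage, Finset.coe_filter, Finset.mem_range, Set.mem_setOf_eq, pat_lt, true_and]

/-! ### The law of the cells -/

variable (w : Sym2 V → unitInterval)

/-- **The law of the 15 cells**: `cellLaw π = P(pattern = π)` (zero for `π ≥ 15`). [this work] -/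
noncomputable def cellLaw (π : ℕ) : ℝ := (prodBernoulli w).real (pat a b c y ⁻¹' {π})

/-- Cells are nonnegative. [this work] -/
theorem cellLaw_nonneg (π : ℕ) : 0 ≤ cellLaw a b c y w π := measureReal_nonneg

variable [Fintype V]

/-- Every event is measurable (finite vertex type). [this work] -/
theorem measurableSet_of_fintype (X : Set (BondConfig V)) : MeasurableSet X :=
  (TerminalGluing.determinedBy_coe_univ X).measurableSet_of_finset

/-- **Dictionary**: the probability of a mask event is the mask sum of the cell law. [this work] -/
theorem real_pre (T : ℕ) : (prodBernoulli w).real (pre a b c y T) = msum T (cellLaw a b c y w) := by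
  rw [pre_eq_preimage, ← sum_measureReal_preimage_singleton _ (fun π _ => measurableSet_of_fintype _), msum, Finset.sum_filter]
  rfl

/-- The cells sum to one. [this work] -/
theorem msum_full_cellLaw : msum full (cellLaw a b c y w) = 1 := by
  rw [← real_pre, pre_full, probReal_univ]

end FourPointCert

end Summit.CriticalPhenomena.PercolationContinuityZ3.Theorems
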